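import Literature.AlgebraicGeometry.HodgeTheory.FermatConeSpanMirror
import Literature.AlgebraicGeometry.HodgeTheory.FermatConeSpanRepresentsLeftHolds
import HarnessLib

/-!
# The cone-span leaf (III-r) of Aoki's Thm. 1-4 (i): `Shioda1979_coneSpan_represents_right` holds

References: N. Aoki, *Some new algebraic cycles on Fermat varieties*, J. Math. Soc. Japan 39 (1987),
Thm. 1-4 (i), p. 388 and p. 386 [Aoki1987]; T. Shioda, *The Hodge conjecture for Fermat varieties*,
Math. Ann. 245 (1979), §1 and Thm. I [Shioda1979HodgeFermat]; G. da Silva Jr., Thm. 2.2 (b)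
[daSilva2021HodgeFermat].

The named fact `Shioda1979_coneSpan_represents_right` of `HodgeTheory/FermatJuxtapositionSpans` (the
`s = 0` cone spans: cones over `X1 = {y = 0} ≅ X²ʳₘ` with vertices the `m` points of `X⁰ₘ` represent
`α ∗ β`) is the mirror image of the `r = 0` leaf `Shioda1979_coneSpan_represents_left`, and the tree
already PROVES the implication `Shioda1979_coneSpan_represents_right_of_left`
(`HodgeTheory/FermatConeSpanMirror`: read the left span for `(β, α)` through the coordinate permutation
exchanging the two blocks, `fermatProjector_complexGysin_comp_permAut_ne_zero`). The left leaf is now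
a theorem, `Shioda1979_coneSpan_represents_left_holds` (`HodgeTheory/FermatConeSpanRepresentsLeftHolds`:
the completed cone built from de Jong's vertex blow-up, `exists_fermatConeCoordinates`, fed into
`Shioda1979_coneSpan_represents_left_of_coneCoordinates`). This leaf composes the two.

* `Shioda1979_coneSpan_represents_right_holds` — **the leaf (III-r) holds**, for all `m, r ≥ 1`, every
  `α ∈ 𝔅²ʳₘ` and every Hodge character `β` of `X⁰ₘ`.

No new definitions, no new named facts; standard axioms.
-/

namespace Literature.AlgebraicGeometry.HodgeTheory

/-- **The cone-span leaf (III-r) of Aoki's Thm. 1-4 (i) — the named fact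
`Shioda1979_coneSpan_represents_right` (`HodgeTheory/FermatJuxtapositionSpans`) — DISCHARGED**: for all
`m, r ≥ 1`, every `α ∈ 𝔅²ʳₘ` and every Hodge character `β` of `X⁰ₘ` (the `m` points of `ℙ¹`), there is
a span `X²ʳₘ ←π— E —φ→ X^{2(r+0+1)}ₘ` of smooth projective varieties (`π` flat, `dim E = 2r + 1`) and
`v ∈ V(α)` with `π_{α∗β}(φ_*(π^* v)) ≠ 0` — the completed cones over `X1 = {y = 0} ≅ X²ʳₘ` joining it
to the points of `X⁰ₘ`. Obtained from the left leaf `Shioda1979_coneSpan_represents_left_holds` (cones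
over `X2 = {x = 0}`) by the block-exchanging coordinate permutation,
`Shioda1979_coneSpan_represents_right_of_left` (Aoki 1987 §1 "`α ∼ β`": `V(α∗β)` and `V(β∗α)` are
identified by the permutation automorphism of the Fermat variety).
[cite: Aoki1987, Thm. 1-4 (i) p. 388 and p. 386] [cite: Shioda1979HodgeFermat, §1 and Thm. I]
[cite: daSilva2021HodgeFermat, Thm. 2.2 (b)] -/
theorem Shioda1979_coneSpan_represents_right_holds : Shioda1979_coneSpan_represents_right :=
  Shioda1979_coneSpan_represents_right_of_left Shioda1979_coneSpan_represents_left_holds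

end Literature.AlgebraicGeometry.HodgeTheory
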